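import Summits.Ventures.CertifiedManyBodySolver.Rows.CorrWindowCertKernelChainQuotFamily
import Summits.Ventures.CertifiedManyBodySolver.Downfold.PinnedPairTPrimeWide
import HarnessLib

/-!
# PINNED `t′`-PAIR nodes‴ (WN shapes) FROM TWO HINTED (symmetry-QUOTIENT) STAGED KERNEL REPLAYS sharing ONE eom word list, on ANY outer letter
# window `Λ' ⊇ box 2 7` (the exporter's tables, e.g. `BoxGeom.boxQuot 6 12 6`) — the quotient-chain corollaries of the WIDE WN entries (`Downfold/PinnedPairTPrimeWide.lean`)

Venture CertifiedManyBodySolver; cell `hubbard-obs` / D-0154 (1)(C) COVERAGE; seat `hubbard-cov-la214-box-2` (g3); captain hubbard-cov-la214-plan-1 g3 (hubbard-obs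
STATUS 2026-08-28T23:00:33Z: «both pair paths 3-line corollaries» of hubbard-obs-p2's hinted-quotient chain). One-writer rulings respected: the quotient step, its
soundness and closers are hubbard-obs-p2's `Rows/CorrWindowCertKernelChainQuot{,Adj,AdjCloser}.lean` / `…EomLocality.lean` (p675151 / p677450 / p677853 / …) and
the ACCEPTED-FAMILY interface (`allMovesZ_ok`, `shiftSet_subset_of_ok`, `d_gq_of_moves`, `evalPoly_quotAdjChain{Near,}_residTG`) is
`Rows/CorrWindowCertKernelChainQuotFamily.lean` in hubbard-obs-p2's namespace (captain RULING R-g3-7, hubbard-obs STATUS 2026-08-28T23:03:50Z); the T-shape twin is hubbard-cov-la214-unc-2's; THIS file = the WN / objective-family twins BY IMPORT.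

WHY: a La214 certificate is solved in ORBIT coordinates; replayed over raw words its symmetry identifications ride with the slices as UNTRUSTED hints, each
accepted hint = one licensed affine-`D₄` move; the accepted moves of the whole chain ARE the window identity's symmetry family. Per vertex the chain facts
therefore give the SEMANTIC residual hypothesis `hR_v` of FILE E WITH that family (`evalPoly_quotAdjChain{Near,}_residTG`), its geometry (`shiftSet_subset_of_ok`,
`d_gq_of_moves` from the
index tables + the validator facts `hokV`), and nothing else is needed: `TPrimePinnedPair{Family,}RowWN.of_residPolys_wide` concludes (letters on `Λ'`, objectives `Γ(incl h7)(X s_v)`).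

* §1 `TPrimePinnedPair{Family,}RowWN.of_quotAdjChainNearKernelCerts_wide` — THE INPUT SHAPE OF THE CLOSER OF RECORD (hubbard-obs-p2's
  `affineOrbitLowerRowN_of_quotAdjChainKernelCertTBNear`): per vertex a `stepEQA` chain `ChainQAOK D Bkey M_v Cs_v (groupSlices (residTGslicesNear TX_v μ_v ν_v o κ_v cap_v
  κ_v′ fl_v TE_v TGs_v TH_v D.f EB masks_v elim0 elim0 CW_v AV_v) ns_v) Hs_v` over the eom-local NEAR slices (`masks_v` + the decidable far check `hfar_v : eomFarOK TH_v
  D.f EB masks_v = true`), symmetry by checked hints (zero-class rule), adjoint identification automatic, ABSTRACT Gram slices `TGs_v` (`termOp d TGs_v.flatten = gramForm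
  Λ_v O_v`, `Λ_v ⪰ 0`; the two-level instance passes `gramTBslices K blocks` + `by rw [flatten_gramTBslices, termOp_gramTB_eq_gramForm]` + `gramTBCoef_posSemidef`, any other
  Gram organisation its own two lemmas), empty start `Cs_v.getD 0 [] = []`, ONE inequality `β_v ≤ lowerConst (decPoly N (Cs_v.getD M_v [])) + (μ_v 0 + μ_v 1)(n₀/2 − ν_v)`,
  slope `sl_v`; shared tables `D : QuotData N Nβ` with their specs (`hxs hix hxsβ hcovβ`, letters `hdx` / `hdΛ` on `Λ' ⊇ box 2 7`, push `hf`), validator table fact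
  `hokV` (no `hokS`: the WN pair law symmetrises over all of `D₄`), ONE shared `EB`, objectives `hX_v : termOp d TX_v = fermionEmbed (PolySite.incl h7) (X s_v)` ⟹ the
  WN pair node‴ (family / constant word). §2 `…of_quotAdjChainKernelCerts_wide` ×2 — the same over the full slices `residTGslices` (no eom masks).
  Proof per vertex: `allMovesZ_ok` ⇒ `shiftSet_subset_of_ok` ⇒ `d_gq_of_moves` ⇒ `evalPoly_quotAdjChain{Near,}_residTG` (the family file
  `Rows/CorrWindowCertKernelChainQuotFamily.lean`) ⇒ `…of_residPolys_wide` (`Downfold/PinnedPairTPrimeWide.lean`).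

EFFECT: hinted-quotient chain output — the format a tree-feasible Rm2-class instance actually takes (hubbard-obs STATUS 2026-08-28T22:21:56Z (3)) — reaches every WN
pair node‴ with no further Lean; the M2(c) leaf follows by `La214M2c_StiffnessBoxCeiling_of_pairRows` (p674101) in one more line (instance writers compose; a
four-vertex closer is not retyped here). Instantiated by NO certificate (no chain of record exists; the M2(c) certificates of record are EXT5-L⁺-class — interface
typing, not a forecast).
HONEST FRAMING: Lean plumbing; evaluates nothing, discharges NO node; no number of record / tier / hold / box word / registry row changes (M2(c) edition of record
`…_cQ` p660755, box word 0.4001659, margin 0.0015674); CONTROL / CALIBRATION class (wording (xx1)); a ceiling never speaks to the presence of superconductivity or to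
`ρ_s = 0`; no `T_c` / phase sentence; nothing about La₁.₈₇₅Sr₀.₁₂₅CuO₄ samples; no item, rung leaf or summit statement is proved here. Zero compute.

References: X. Han, arXiv:2006.06002, §3 [cite: Han2020Bootstrap, §3]; J. Wang et al., PRX 14 (2024) 031006, §III [cite: WangEtAl2024, §III]; C. Jansson,
D. Chaykin, C. Keil, SIAM J. Numer. Anal. 46 (2008) 180, §3 [cite: JanssonChaykinKeil2008, §3].
-/

noncomputable section

namespace Summit.Ventures.CertifiedManyBodySolver.Downfold

open Literature.MathematicalPhysics.QuantumLattice
open Matrix HubbardWave0 Literature.Probability.LatticeModels ThermodynamicLimit Filter Topology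
open Literature.MathematicalPhysics.QuantumManyBody.StateRelaxation
open Summit.Ventures.CertifiedQuantumChemistry Summit.Ventures.CertifiedQuantumChemistry.CARPoly
open Summit.Ventures.CertifiedManyBodySolver.CARPolyWindow
open scoped BigOperators ComplexOrder

section QuotChainPair

variable {N Nβ : ℕ} [NeZero N]

/-! ## §1 The editions OF RECORD: `stepEQA` chains over the eom-local NEAR slices (hubbard-obs-p2's closer of record `…TBNear`) -/

/-- **WN-FAMILY PAIR NODE‴ FROM TWO `stepEQA` CHAINS OVER THE EOM-LOCAL (NEAR) SLICES — THE CLOSER OF RECORD'S INPUT** (ABSTRACT Gram slices `TGs_v` with `termOp d TGs_v.flatten = gramForm Λ_v O_v`, `Λ_v ⪰ 0` — two-level `gramTBslices` or any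
other organisation; per eom generator only the NEAR Hamiltonian terms, far check `eomFarOK` decidable; symmetry by checked hints, adjoint automatic; empty start; ONE shared `EB`): per vertex `ChainQAOK …` + `β_v ≤ lowerConst (decPoly N C_{M_v}) + (μ_v 0 + μ_v 1)(n₀/2 − ν_v)` +
`sl_v = (μ_v 0 + μ_v 1)/2`, shared index tables with their specs and the validator table fact ⟹ the family pair row. [cite: Han2020Bootstrap, §3]
[cite: WangEtAl2024, §III] [cite: JanssonChaykinKeil2008, §3] -/
theorem TPrimePinnedPairFamilyRowWN.of_quotAdjChainNearKernelCerts_wide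
    (U : ℚ) (hU : 0 ≤ U) (n₀ sA sB : ℚ)
    {Λ Λ' : Finset (Site 2)} (h7 : Literature.Probability.LatticeModels.box 2 7 ⊆ Λ') (hΛ : Λ ⊆ Λ') (h8 : thicken Λ 1 ⊆ Λ')
    (h0 : thicken ({0} : Finset (Site 2)) 1 ⊆ Λ') (hz : (0 : Site 2) ∈ Λ')
    -- index tables and letters (shared): hubbard-obs-p2's `QuotData`
    (D : QuotData N Nβ) (hxs : ∀ i, D.xs i ∈ Λ') (hix : ∀ y ∈ Λ', D.xs (D.ix y) = y)
    (hxsβ : ∀ j, D.xsβ j ∈ Λ) (hcovβ : ∀ x ∈ Λ, ∃ j, D.xsβ j = x)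
    (d : Orb (Fin N) → Orb (PolySite Λ')) (hd : Function.Injective d)
    (hdx : ∀ i σ, d (orb i σ) = orb (PolySite.pt (D.xs i) (hxs i)) σ) (Bkey : ℕ)
    (dΛ : Orb (Fin Nβ) → Orb (PolySite Λ)) (hdΛ : ∀ j σ, dΛ (orb j σ) = orb (PolySite.pt (D.xsβ j) (hxsβ j)) σ)
    (hf : ∀ b, d (D.f b) = Orb.embMap (PolySite.incl hΛ) (dΛ b))
    (sp : Orb (Fin N) → Fin 2) (hsp : ∀ a, (ofLex (d a)).2 = sp a)
    -- licensed moves keep the inner window inside the outer one (table form, `decide`-class per geometry)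
    (hokV : ∀ γc v, D.ok γc v = true →
      ∀ j : Fin Nβ, D.xs (D.ix (d4Vec (d4OfCode γc) (D.xsβ j) + siteOfPair v)) = d4Vec (d4OfCode γc) (D.xsβ j) + siteOfPair v)
    (o : Fin 2 → Orb (Fin N)) (ho : ∀ σ, d (o σ) = orb (PolySite.pt 0 hz) σ)
    (X : ℝ → FermionOp (Literature.Probability.LatticeModels.box 2 7)) (EB : List (Terms (Orb (Fin Nβ))))
    -- vertex A
    (THA : Terms (Orb (Fin N)))
    (hHA : termOp d THA = (hubbardTTPrimeFermionInteraction 1 (sA : ℝ) (U : ℝ)).localHamiltonian Λ')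
    (TEA : Terms (Orb (Fin N)))
    (hEA : termOp d TEA = fermionEmbed (PolySite.incl h0) ((hubbardTTPrimeFermionInteraction 1 (sA : ℝ) (U : ℝ)).meanEnergyObs 1))
    (TXA : Terms (Orb (Fin N))) (hXA : termOp d TXA = fermionEmbed (PolySite.incl h7) (X (sA : ℝ))) (μA : Fin 2 → ℚ) (νA κA capA κA' flA : ℚ)
    (TGsA : List (Terms (Orb (Fin N)))) {mA : Type*} [Fintype mA] [DecidableEq mA] {ΛmA : Matrix mA mA ℂ} (hΛmA : ΛmA.PosSemidef)
    (OA : mA → FermionOp Λ') (hGA : termOp d TGsA.flatten = gramForm ΛmA OA)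
    (CWA : Terms (Orb (Fin N))) (hcwA : ∀ wc ∈ CWA, chargeW wc.1 ≠ 0 ∨ spinChargeW sp wc.1 ≠ 0) (AVA : List (Terms (Orb (Fin N))))
    (masksA : List (List Bool)) (hfarA : eomFarOK THA D.f EB masksA = true)
    (nsA : List ℕ) (MA : ℕ) (CsA : List SOSDual.EncPoly) (hC0A : CsA.getD 0 [] = []) (HsA : List (List (QHint Nβ)))
    (hchainA : ChainQAOK D Bkey MA CsA
      (groupSlices (residTGslicesNear TXA μA νA o κA capA κA' flA TEA TGsA THA D.f EB masksA
        (fun l : Fin 0 => l.elim0) (fun l : Fin 0 => l.elim0) CWA AVA) nsA) HsA)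
    {βA : ℚ} (hβA : βA ≤ lowerConst (SOSDual.decPoly N (CsA.getD MA [])) + (μA 0 + μA 1) * (n₀ / 2 - νA))
    {slA : ℚ} (hslA : slA = (μA 0 + μA 1) / 2)
    -- vertex B
    (THB : Terms (Orb (Fin N)))
    (hHB : termOp d THB = (hubbardTTPrimeFermionInteraction 1 (sB : ℝ) (U : ℝ)).localHamiltonian Λ')
    (TEB : Terms (Orb (Fin N)))
    (hEB : termOp d TEB = fermionEmbed (PolySite.incl h0) ((hubbardTTPrimeFermionInteraction 1 (sB : ℝ) (U : ℝ)).meanEnergyObs 1))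
    (TXB : Terms (Orb (Fin N))) (hXB : termOp d TXB = fermionEmbed (PolySite.incl h7) (X (sB : ℝ))) (μB : Fin 2 → ℚ) (νB κB capB κB' flB : ℚ)
    (TGsB : List (Terms (Orb (Fin N)))) {mB : Type*} [Fintype mB] [DecidableEq mB] {ΛmB : Matrix mB mB ℂ} (hΛmB : ΛmB.PosSemidef)
    (OB : mB → FermionOp Λ') (hGB : termOp d TGsB.flatten = gramForm ΛmB OB)
    (CWB : Terms (Orb (Fin N))) (hcwB : ∀ wc ∈ CWB, chargeW wc.1 ≠ 0 ∨ spinChargeW sp wc.1 ≠ 0) (AVB : List (Terms (Orb (Fin N))))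
    (masksB : List (List Bool)) (hfarB : eomFarOK THB D.f EB masksB = true)
    (nsB : List ℕ) (MB : ℕ) (CsB : List SOSDual.EncPoly) (hC0B : CsB.getD 0 [] = []) (HsB : List (List (QHint Nβ)))
    (hchainB : ChainQAOK D Bkey MB CsB
      (groupSlices (residTGslicesNear TXB μB νB o κB capB κB' flB TEB TGsB THB D.f EB masksB
        (fun l : Fin 0 => l.elim0) (fun l : Fin 0 => l.elim0) CWB AVB) nsB) HsB)
    {βB : ℚ} (hβB : βB ≤ lowerConst (SOSDual.decPoly N (CsB.getD MB [])) + (μB 0 + μB 1) * (n₀ / 2 - νB))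
    {slB : ℚ} (hslB : slB = (μB 0 + μB 1) / 2) :
    TPrimePinnedPairFamilyRowWN (U : ℝ) (sA : ℝ) (sB : ℝ) capA capB flA flB βA κA κA' slA βB κB κB' slB n₀ X := by
  -- the accepted move lists of the two chains
  set LA := allMovesZ D Bkey (groupSlices (residTGslicesNear TXA μA νA o κA capA κA' flA TEA TGsA THA D.f EB masksA
    (fun l : Fin 0 => l.elim0) (fun l : Fin 0 => l.elim0) CWA AVA) nsA) HsA MA with hLA
  set LB := allMovesZ D Bkey (groupSlices (residTGslicesNear TXB μB νB o κB capB κB' flB TEB TGsB THB D.f EB masksB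
    (fun l : Fin 0 => l.elim0) (fun l : Fin 0 => l.elim0) CWB AVB) nsB) HsB MB with hLB
  -- every accepted move is licensed ⇒ geometry of the rebuilt families from the tables
  have hokA : ∀ mv ∈ LA, D.ok mv.1 mv.2.1 = true := allMovesZ_ok D Bkey _ HsA MA
  have hokB : ∀ mv ∈ LB, D.ok mv.1 mv.2.1 = true := allMovesZ_ok D Bkey _ HsB MB
  have hshA : ∀ l : Fin LA.length, d4ShiftSet (d4OfCode (LA.get l).1) (siteOfPair (LA.get l).2.1) Λ ⊆ Λ' :=
    shiftSet_subset_of_ok D hxs hcovβ hokV LA hokA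
  have hshB : ∀ l : Fin LB.length, d4ShiftSet (d4OfCode (LB.get l).1) (siteOfPair (LB.get l).2.1) Λ ⊆ Λ' :=
    shiftSet_subset_of_ok D hxs hcovβ hokV LB hokB
  have hgA := d_gq_of_moves D hxs d hdx hix hxsβ dΛ hdΛ LA hshA
  have hgB := d_gq_of_moves D hxs d hdx hix hxsβ dΛ hdΛ LB hshB
  -- the SEMANTIC residuals WITH the accepted families
  have hRA := evalPoly_quotAdjChainNear_residTG hd D Bkey TXA μA νA o κA capA κA' flA TEA TGsA THA EB masksA hfarA
    CWA AVA nsA MA CsA hC0A HsA hchainA LA hLA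
  have hRB := evalPoly_quotAdjChainNear_residTG hd D Bkey TXB μB νB o κB capB κB' flB TEB TGsB THB EB masksB hfarB
    CWB AVB nsB MB CsB hC0B HsB hchainB LB hLB
  exact TPrimePinnedPairFamilyRowWN.of_residPolys_wide U hU n₀ sA sB h7 hΛ h8 h0 hz d dΛ D.f hf sp hsp o ho X EB
    THA hHA TEA hEA TXA hXA μA νA κA capA κA' flA TGsA.flatten hΛmA OA hGA _ _ hshA _ hgA _ CWA hcwA _ hRA hβA hslA
    THB hHB TEB hEB TXB hXB μB νB κB capB κB' flB TGsB.flatten hΛmB OB hGB _ _ hshB _ hgB _ CWB hcwB _ hRB hβB hslB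

/-- **CONSTANT-OBJECTIVE WN PAIR NODE‴ FROM TWO `stepEQA` CHAINS OVER THE NEAR SLICES (closer-of-record input)** (`TPrimePinnedPairRowWN … X₀`), via
`TPrimePinnedPairRowWN_iff_family`. [cite: Han2020Bootstrap, §3] [cite: WangEtAl2024, §III] -/
theorem TPrimePinnedPairRowWN.of_quotAdjChainNearKernelCerts_wide
    (U : ℚ) (hU : 0 ≤ U) (n₀ sA sB : ℚ)
    {Λ Λ' : Finset (Site 2)} (h7 : Literature.Probability.LatticeModels.box 2 7 ⊆ Λ') (hΛ : Λ ⊆ Λ') (h8 : thicken Λ 1 ⊆ Λ')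
    (h0 : thicken ({0} : Finset (Site 2)) 1 ⊆ Λ') (hz : (0 : Site 2) ∈ Λ')
    (D : QuotData N Nβ) (hxs : ∀ i, D.xs i ∈ Λ') (hix : ∀ y ∈ Λ', D.xs (D.ix y) = y)
    (hxsβ : ∀ j, D.xsβ j ∈ Λ) (hcovβ : ∀ x ∈ Λ, ∃ j, D.xsβ j = x)
    (d : Orb (Fin N) → Orb (PolySite Λ')) (hd : Function.Injective d)
    (hdx : ∀ i σ, d (orb i σ) = orb (PolySite.pt (D.xs i) (hxs i)) σ) (Bkey : ℕ)
    (dΛ : Orb (Fin Nβ) → Orb (PolySite Λ)) (hdΛ : ∀ j σ, dΛ (orb j σ) = orb (PolySite.pt (D.xsβ j) (hxsβ j)) σ)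
    (hf : ∀ b, d (D.f b) = Orb.embMap (PolySite.incl hΛ) (dΛ b))
    (sp : Orb (Fin N) → Fin 2) (hsp : ∀ a, (ofLex (d a)).2 = sp a)
    (hokV : ∀ γc v, D.ok γc v = true →
      ∀ j : Fin Nβ, D.xs (D.ix (d4Vec (d4OfCode γc) (D.xsβ j) + siteOfPair v)) = d4Vec (d4OfCode γc) (D.xsβ j) + siteOfPair v)
    (o : Fin 2 → Orb (Fin N)) (ho : ∀ σ, d (o σ) = orb (PolySite.pt 0 hz) σ)
    (X₀ : FermionOp (Literature.Probability.LatticeModels.box 2 7)) (EB : List (Terms (Orb (Fin Nβ))))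
    -- vertex A
    (THA : Terms (Orb (Fin N)))
    (hHA : termOp d THA = (hubbardTTPrimeFermionInteraction 1 (sA : ℝ) (U : ℝ)).localHamiltonian Λ')
    (TEA : Terms (Orb (Fin N)))
    (hEA : termOp d TEA = fermionEmbed (PolySite.incl h0) ((hubbardTTPrimeFermionInteraction 1 (sA : ℝ) (U : ℝ)).meanEnergyObs 1))
    (TXA : Terms (Orb (Fin N))) (hXA : termOp d TXA = fermionEmbed (PolySite.incl h7) X₀) (μA : Fin 2 → ℚ) (νA κA capA κA' flA : ℚ)
    (TGsA : List (Terms (Orb (Fin N)))) {mA : Type*} [Fintype mA] [DecidableEq mA] {ΛmA : Matrix mA mA ℂ} (hΛmA : ΛmA.PosSemidef)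
    (OA : mA → FermionOp Λ') (hGA : termOp d TGsA.flatten = gramForm ΛmA OA)
    (CWA : Terms (Orb (Fin N))) (hcwA : ∀ wc ∈ CWA, chargeW wc.1 ≠ 0 ∨ spinChargeW sp wc.1 ≠ 0) (AVA : List (Terms (Orb (Fin N))))
    (masksA : List (List Bool)) (hfarA : eomFarOK THA D.f EB masksA = true)
    (nsA : List ℕ) (MA : ℕ) (CsA : List SOSDual.EncPoly) (hC0A : CsA.getD 0 [] = []) (HsA : List (List (QHint Nβ)))
    (hchainA : ChainQAOK D Bkey MA CsA
      (groupSlices (residTGslicesNear TXA μA νA o κA capA κA' flA TEA TGsA THA D.f EB masksA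
        (fun l : Fin 0 => l.elim0) (fun l : Fin 0 => l.elim0) CWA AVA) nsA) HsA)
    {βA : ℚ} (hβA : βA ≤ lowerConst (SOSDual.decPoly N (CsA.getD MA [])) + (μA 0 + μA 1) * (n₀ / 2 - νA))
    {slA : ℚ} (hslA : slA = (μA 0 + μA 1) / 2)
    -- vertex B
    (THB : Terms (Orb (Fin N)))
    (hHB : termOp d THB = (hubbardTTPrimeFermionInteraction 1 (sB : ℝ) (U : ℝ)).localHamiltonian Λ')
    (TEB : Terms (Orb (Fin N)))
    (hEB : termOp d TEB = fermionEmbed (PolySite.incl h0) ((hubbardTTPrimeFermionInteraction 1 (sB : ℝ) (U : ℝ)).meanEnergyObs 1))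
    (TXB : Terms (Orb (Fin N))) (hXB : termOp d TXB = fermionEmbed (PolySite.incl h7) X₀) (μB : Fin 2 → ℚ) (νB κB capB κB' flB : ℚ)
    (TGsB : List (Terms (Orb (Fin N)))) {mB : Type*} [Fintype mB] [DecidableEq mB] {ΛmB : Matrix mB mB ℂ} (hΛmB : ΛmB.PosSemidef)
    (OB : mB → FermionOp Λ') (hGB : termOp d TGsB.flatten = gramForm ΛmB OB)
    (CWB : Terms (Orb (Fin N))) (hcwB : ∀ wc ∈ CWB, chargeW wc.1 ≠ 0 ∨ spinChargeW sp wc.1 ≠ 0) (AVB : List (Terms (Orb (Fin N))))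
    (masksB : List (List Bool)) (hfarB : eomFarOK THB D.f EB masksB = true)
    (nsB : List ℕ) (MB : ℕ) (CsB : List SOSDual.EncPoly) (hC0B : CsB.getD 0 [] = []) (HsB : List (List (QHint Nβ)))
    (hchainB : ChainQAOK D Bkey MB CsB
      (groupSlices (residTGslicesNear TXB μB νB o κB capB κB' flB TEB TGsB THB D.f EB masksB
        (fun l : Fin 0 => l.elim0) (fun l : Fin 0 => l.elim0) CWB AVB) nsB) HsB)
    {βB : ℚ} (hβB : βB ≤ lowerConst (SOSDual.decPoly N (CsB.getD MB [])) + (μB 0 + μB 1) * (n₀ / 2 - νB))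
    {slB : ℚ} (hslB : slB = (μB 0 + μB 1) / 2) :
    TPrimePinnedPairRowWN (U : ℝ) (sA : ℝ) (sB : ℝ) capA capB flA flB βA κA κA' slA βB κB κB' slB n₀ X₀ :=
  (TPrimePinnedPairRowWN_iff_family).2
    (TPrimePinnedPairFamilyRowWN.of_quotAdjChainNearKernelCerts_wide U hU n₀ sA sB h7 hΛ h8 h0 hz D hxs hix hxsβ hcovβ d hd hdx Bkey dΛ hdΛ hf sp hsp
      hokV o ho (fun _ => X₀) EB
      THA hHA TEA hEA TXA hXA μA νA κA capA κA' flA TGsA hΛmA OA hGA CWA hcwA AVA masksA hfarA nsA MA CsA hC0A HsA hchainA hβA hslA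
      THB hHB TEB hEB TXB hXB μB νB κB capB κB' flB TGsB hΛmB OB hGB CWB hcwB AVB masksB hfarB nsB MB CsB hC0B HsB hchainB hβB hslB)

/-! ## §2 The `stepEQA` editions over the full slices (no eom masks) -/

/-- **WN-FAMILY PAIR NODE‴ FROM TWO HINTED + ADJOINT-CANONICALISED STAGED KERNEL REPLAYS (`stepEQA`, the step of record)** (two-level Gram slices; no
symmetry slices, adjoint identification automatic — both families rebuilt from the chain; empty start; ONE shared `EB`): per vertex `ChainQAOK …` + `β_v ≤ lowerConst (decPoly N C_{M_v}) + (μ_v 0 + μ_v 1)(n₀/2 − ν_v)` +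
`sl_v = (μ_v 0 + μ_v 1)/2`, shared index tables with their specs and the validator table fact ⟹ the family pair row. [cite: Han2020Bootstrap, §3]
[cite: WangEtAl2024, §III] [cite: JanssonChaykinKeil2008, §3] -/
theorem TPrimePinnedPairFamilyRowWN.of_quotAdjChainKernelCerts_wide
    (U : ℚ) (hU : 0 ≤ U) (n₀ sA sB : ℚ)
    {Λ Λ' : Finset (Site 2)} (h7 : Literature.Probability.LatticeModels.box 2 7 ⊆ Λ') (hΛ : Λ ⊆ Λ') (h8 : thicken Λ 1 ⊆ Λ')
    (h0 : thicken ({0} : Finset (Site 2)) 1 ⊆ Λ') (hz : (0 : Site 2) ∈ Λ')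
    -- index tables and letters (shared): hubbard-obs-p2's `QuotData`
    (D : QuotData N Nβ) (hxs : ∀ i, D.xs i ∈ Λ') (hix : ∀ y ∈ Λ', D.xs (D.ix y) = y)
    (hxsβ : ∀ j, D.xsβ j ∈ Λ) (hcovβ : ∀ x ∈ Λ, ∃ j, D.xsβ j = x)
    (d : Orb (Fin N) → Orb (PolySite Λ')) (hd : Function.Injective d)
    (hdx : ∀ i σ, d (orb i σ) = orb (PolySite.pt (D.xs i) (hxs i)) σ) (Bkey : ℕ)
    (dΛ : Orb (Fin Nβ) → Orb (PolySite Λ)) (hdΛ : ∀ j σ, dΛ (orb j σ) = orb (PolySite.pt (D.xsβ j) (hxsβ j)) σ)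
    (hf : ∀ b, d (D.f b) = Orb.embMap (PolySite.incl hΛ) (dΛ b))
    (sp : Orb (Fin N) → Fin 2) (hsp : ∀ a, (ofLex (d a)).2 = sp a)
    -- licensed moves keep the inner window inside the outer one (table form, `decide`-class per geometry)
    (hokV : ∀ γc v, D.ok γc v = true →
      ∀ j : Fin Nβ, D.xs (D.ix (d4Vec (d4OfCode γc) (D.xsβ j) + siteOfPair v)) = d4Vec (d4OfCode γc) (D.xsβ j) + siteOfPair v)
    (o : Fin 2 → Orb (Fin N)) (ho : ∀ σ, d (o σ) = orb (PolySite.pt 0 hz) σ)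
    (X : ℝ → FermionOp (Literature.Probability.LatticeModels.box 2 7)) (EB : List (Terms (Orb (Fin Nβ))))
    -- vertex A
    (THA : Terms (Orb (Fin N)))
    (hHA : termOp d THA = (hubbardTTPrimeFermionInteraction 1 (sA : ℝ) (U : ℝ)).localHamiltonian Λ')
    (TEA : Terms (Orb (Fin N)))
    (hEA : termOp d TEA = fermionEmbed (PolySite.incl h0) ((hubbardTTPrimeFermionInteraction 1 (sA : ℝ) (U : ℝ)).meanEnergyObs 1))
    (TXA : Terms (Orb (Fin N))) (hXA : termOp d TXA = fermionEmbed (PolySite.incl h7) (X (sA : ℝ))) (μA : Fin 2 → ℚ) (νA κA capA κA' flA : ℚ)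
    (TGsA : List (Terms (Orb (Fin N)))) {mA : Type*} [Fintype mA] [DecidableEq mA] {ΛmA : Matrix mA mA ℂ} (hΛmA : ΛmA.PosSemidef)
    (OA : mA → FermionOp Λ') (hGA : termOp d TGsA.flatten = gramForm ΛmA OA)
    (CWA : Terms (Orb (Fin N))) (hcwA : ∀ wc ∈ CWA, chargeW wc.1 ≠ 0 ∨ spinChargeW sp wc.1 ≠ 0) (AVA : List (Terms (Orb (Fin N))))
    (nsA : List ℕ) (MA : ℕ) (CsA : List SOSDual.EncPoly) (hC0A : CsA.getD 0 [] = []) (HsA : List (List (QHint Nβ)))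
    (hchainA : ChainQAOK D Bkey MA CsA
      (groupSlices (residTGslices TXA μA νA o κA capA κA' flA TEA TGsA THA D.f EB
        (fun l : Fin 0 => l.elim0) (fun l : Fin 0 => l.elim0) CWA AVA) nsA) HsA)
    {βA : ℚ} (hβA : βA ≤ lowerConst (SOSDual.decPoly N (CsA.getD MA [])) + (μA 0 + μA 1) * (n₀ / 2 - νA))
    {slA : ℚ} (hslA : slA = (μA 0 + μA 1) / 2)
    -- vertex B
    (THB : Terms (Orb (Fin N)))
    (hHB : termOp d THB = (hubbardTTPrimeFermionInteraction 1 (sB : ℝ) (U : ℝ)).localHamiltonian Λ')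
    (TEB : Terms (Orb (Fin N)))
    (hEB : termOp d TEB = fermionEmbed (PolySite.incl h0) ((hubbardTTPrimeFermionInteraction 1 (sB : ℝ) (U : ℝ)).meanEnergyObs 1))
    (TXB : Terms (Orb (Fin N))) (hXB : termOp d TXB = fermionEmbed (PolySite.incl h7) (X (sB : ℝ))) (μB : Fin 2 → ℚ) (νB κB capB κB' flB : ℚ)
    (TGsB : List (Terms (Orb (Fin N)))) {mB : Type*} [Fintype mB] [DecidableEq mB] {ΛmB : Matrix mB mB ℂ} (hΛmB : ΛmB.PosSemidef)
    (OB : mB → FermionOp Λ') (hGB : termOp d TGsB.flatten = gramForm ΛmB OB)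
    (CWB : Terms (Orb (Fin N))) (hcwB : ∀ wc ∈ CWB, chargeW wc.1 ≠ 0 ∨ spinChargeW sp wc.1 ≠ 0) (AVB : List (Terms (Orb (Fin N))))
    (nsB : List ℕ) (MB : ℕ) (CsB : List SOSDual.EncPoly) (hC0B : CsB.getD 0 [] = []) (HsB : List (List (QHint Nβ)))
    (hchainB : ChainQAOK D Bkey MB CsB
      (groupSlices (residTGslices TXB μB νB o κB capB κB' flB TEB TGsB THB D.f EB
        (fun l : Fin 0 => l.elim0) (fun l : Fin 0 => l.elim0) CWB AVB) nsB) HsB)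
    {βB : ℚ} (hβB : βB ≤ lowerConst (SOSDual.decPoly N (CsB.getD MB [])) + (μB 0 + μB 1) * (n₀ / 2 - νB))
    {slB : ℚ} (hslB : slB = (μB 0 + μB 1) / 2) :
    TPrimePinnedPairFamilyRowWN (U : ℝ) (sA : ℝ) (sB : ℝ) capA capB flA flB βA κA κA' slA βB κB κB' slB n₀ X := by
  -- the accepted move lists of the two chains
  set LA := allMovesZ D Bkey (groupSlices (residTGslices TXA μA νA o κA capA κA' flA TEA TGsA THA D.f EB
    (fun l : Fin 0 => l.elim0) (fun l : Fin 0 => l.elim0) CWA AVA) nsA) HsA MA with hLA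
  set LB := allMovesZ D Bkey (groupSlices (residTGslices TXB μB νB o κB capB κB' flB TEB TGsB THB D.f EB
    (fun l : Fin 0 => l.elim0) (fun l : Fin 0 => l.elim0) CWB AVB) nsB) HsB MB with hLB
  -- every accepted move is licensed ⇒ geometry of the rebuilt families from the tables
  have hokA : ∀ mv ∈ LA, D.ok mv.1 mv.2.1 = true := allMovesZ_ok D Bkey _ HsA MA
  have hokB : ∀ mv ∈ LB, D.ok mv.1 mv.2.1 = true := allMovesZ_ok D Bkey _ HsB MB
  have hshA : ∀ l : Fin LA.length, d4ShiftSet (d4OfCode (LA.get l).1) (siteOfPair (LA.get l).2.1) Λ ⊆ Λ' :=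
    shiftSet_subset_of_ok D hxs hcovβ hokV LA hokA
  have hshB : ∀ l : Fin LB.length, d4ShiftSet (d4OfCode (LB.get l).1) (siteOfPair (LB.get l).2.1) Λ ⊆ Λ' :=
    shiftSet_subset_of_ok D hxs hcovβ hokV LB hokB
  have hgA := d_gq_of_moves D hxs d hdx hix hxsβ dΛ hdΛ LA hshA
  have hgB := d_gq_of_moves D hxs d hdx hix hxsβ dΛ hdΛ LB hshB
  -- the SEMANTIC residuals WITH the accepted families
  have hRA := evalPoly_quotAdjChain_residTG hd D Bkey TXA μA νA o κA capA κA' flA TEA TGsA THA EB CWA AVA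
    nsA MA CsA hC0A HsA hchainA LA hLA
  have hRB := evalPoly_quotAdjChain_residTG hd D Bkey TXB μB νB o κB capB κB' flB TEB TGsB THB EB CWB AVB
    nsB MB CsB hC0B HsB hchainB LB hLB
  exact TPrimePinnedPairFamilyRowWN.of_residPolys_wide U hU n₀ sA sB h7 hΛ h8 h0 hz d dΛ D.f hf sp hsp o ho X EB
    THA hHA TEA hEA TXA hXA μA νA κA capA κA' flA TGsA.flatten hΛmA OA hGA _ _ hshA _ hgA _ CWA hcwA _ hRA hβA hslA
    THB hHB TEB hEB TXB hXB μB νB κB capB κB' flB TGsB.flatten hΛmB OB hGB _ _ hshB _ hgB _ CWB hcwB _ hRB hβB hslB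

/-- **CONSTANT-OBJECTIVE WN PAIR NODE‴ FROM TWO `stepEQA` STAGED KERNEL REPLAYS** (`TPrimePinnedPairRowWN … X₀`), via
`TPrimePinnedPairRowWN_iff_family`. [cite: Han2020Bootstrap, §3] [cite: WangEtAl2024, §III] -/
theorem TPrimePinnedPairRowWN.of_quotAdjChainKernelCerts_wide
    (U : ℚ) (hU : 0 ≤ U) (n₀ sA sB : ℚ)
    {Λ Λ' : Finset (Site 2)} (h7 : Literature.Probability.LatticeModels.box 2 7 ⊆ Λ') (hΛ : Λ ⊆ Λ') (h8 : thicken Λ 1 ⊆ Λ')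
    (h0 : thicken ({0} : Finset (Site 2)) 1 ⊆ Λ') (hz : (0 : Site 2) ∈ Λ')
    (D : QuotData N Nβ) (hxs : ∀ i, D.xs i ∈ Λ') (hix : ∀ y ∈ Λ', D.xs (D.ix y) = y)
    (hxsβ : ∀ j, D.xsβ j ∈ Λ) (hcovβ : ∀ x ∈ Λ, ∃ j, D.xsβ j = x)
    (d : Orb (Fin N) → Orb (PolySite Λ')) (hd : Function.Injective d)
    (hdx : ∀ i σ, d (orb i σ) = orb (PolySite.pt (D.xs i) (hxs i)) σ) (Bkey : ℕ)
    (dΛ : Orb (Fin Nβ) → Orb (PolySite Λ)) (hdΛ : ∀ j σ, dΛ (orb j σ) = orb (PolySite.pt (D.xsβ j) (hxsβ j)) σ)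
    (hf : ∀ b, d (D.f b) = Orb.embMap (PolySite.incl hΛ) (dΛ b))
    (sp : Orb (Fin N) → Fin 2) (hsp : ∀ a, (ofLex (d a)).2 = sp a)
    (hokV : ∀ γc v, D.ok γc v = true →
      ∀ j : Fin Nβ, D.xs (D.ix (d4Vec (d4OfCode γc) (D.xsβ j) + siteOfPair v)) = d4Vec (d4OfCode γc) (D.xsβ j) + siteOfPair v)
    (o : Fin 2 → Orb (Fin N)) (ho : ∀ σ, d (o σ) = orb (PolySite.pt 0 hz) σ)
    (X₀ : FermionOp (Literature.Probability.LatticeModels.box 2 7)) (EB : List (Terms (Orb (Fin Nβ))))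
    -- vertex A
    (THA : Terms (Orb (Fin N)))
    (hHA : termOp d THA = (hubbardTTPrimeFermionInteraction 1 (sA : ℝ) (U : ℝ)).localHamiltonian Λ')
    (TEA : Terms (Orb (Fin N)))
    (hEA : termOp d TEA = fermionEmbed (PolySite.incl h0) ((hubbardTTPrimeFermionInteraction 1 (sA : ℝ) (U : ℝ)).meanEnergyObs 1))
    (TXA : Terms (Orb (Fin N))) (hXA : termOp d TXA = fermionEmbed (PolySite.incl h7) X₀) (μA : Fin 2 → ℚ) (νA κA capA κA' flA : ℚ)
    (TGsA : List (Terms (Orb (Fin N)))) {mA : Type*} [Fintype mA] [DecidableEq mA] {ΛmA : Matrix mA mA ℂ} (hΛmA : ΛmA.PosSemidef)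
    (OA : mA → FermionOp Λ') (hGA : termOp d TGsA.flatten = gramForm ΛmA OA)
    (CWA : Terms (Orb (Fin N))) (hcwA : ∀ wc ∈ CWA, chargeW wc.1 ≠ 0 ∨ spinChargeW sp wc.1 ≠ 0) (AVA : List (Terms (Orb (Fin N))))
    (nsA : List ℕ) (MA : ℕ) (CsA : List SOSDual.EncPoly) (hC0A : CsA.getD 0 [] = []) (HsA : List (List (QHint Nβ)))
    (hchainA : ChainQAOK D Bkey MA CsA
      (groupSlices (residTGslices TXA μA νA o κA capA κA' flA TEA TGsA THA D.f EB
        (fun l : Fin 0 => l.elim0) (fun l : Fin 0 => l.elim0) CWA AVA) nsA) HsA)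
    {βA : ℚ} (hβA : βA ≤ lowerConst (SOSDual.decPoly N (CsA.getD MA [])) + (μA 0 + μA 1) * (n₀ / 2 - νA))
    {slA : ℚ} (hslA : slA = (μA 0 + μA 1) / 2)
    -- vertex B
    (THB : Terms (Orb (Fin N)))
    (hHB : termOp d THB = (hubbardTTPrimeFermionInteraction 1 (sB : ℝ) (U : ℝ)).localHamiltonian Λ')
    (TEB : Terms (Orb (Fin N)))
    (hEB : termOp d TEB = fermionEmbed (PolySite.incl h0) ((hubbardTTPrimeFermionInteraction 1 (sB : ℝ) (U : ℝ)).meanEnergyObs 1))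
    (TXB : Terms (Orb (Fin N))) (hXB : termOp d TXB = fermionEmbed (PolySite.incl h7) X₀) (μB : Fin 2 → ℚ) (νB κB capB κB' flB : ℚ)
    (TGsB : List (Terms (Orb (Fin N)))) {mB : Type*} [Fintype mB] [DecidableEq mB] {ΛmB : Matrix mB mB ℂ} (hΛmB : ΛmB.PosSemidef)
    (OB : mB → FermionOp Λ') (hGB : termOp d TGsB.flatten = gramForm ΛmB OB)
    (CWB : Terms (Orb (Fin N))) (hcwB : ∀ wc ∈ CWB, chargeW wc.1 ≠ 0 ∨ spinChargeW sp wc.1 ≠ 0) (AVB : List (Terms (Orb (Fin N))))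
    (nsB : List ℕ) (MB : ℕ) (CsB : List SOSDual.EncPoly) (hC0B : CsB.getD 0 [] = []) (HsB : List (List (QHint Nβ)))
    (hchainB : ChainQAOK D Bkey MB CsB
      (groupSlices (residTGslices TXB μB νB o κB capB κB' flB TEB TGsB THB D.f EB
        (fun l : Fin 0 => l.elim0) (fun l : Fin 0 => l.elim0) CWB AVB) nsB) HsB)
    {βB : ℚ} (hβB : βB ≤ lowerConst (SOSDual.decPoly N (CsB.getD MB [])) + (μB 0 + μB 1) * (n₀ / 2 - νB))
    {slB : ℚ} (hslB : slB = (μB 0 + μB 1) / 2) :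
    TPrimePinnedPairRowWN (U : ℝ) (sA : ℝ) (sB : ℝ) capA capB flA flB βA κA κA' slA βB κB κB' slB n₀ X₀ :=
  (TPrimePinnedPairRowWN_iff_family).2
    (TPrimePinnedPairFamilyRowWN.of_quotAdjChainKernelCerts_wide U hU n₀ sA sB h7 hΛ h8 h0 hz D hxs hix hxsβ hcovβ d hd hdx Bkey dΛ hdΛ hf sp hsp
      hokV o ho (fun _ => X₀) EB
      THA hHA TEA hEA TXA hXA μA νA κA capA κA' flA TGsA hΛmA OA hGA CWA hcwA AVA nsA MA CsA hC0A HsA hchainA hβA hslA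
      THB hHB TEB hEB TXB hXB μB νB κB capB κB' flB TGsB hΛmB OB hGB CWB hcwB AVB nsB MB CsB hC0B HsB hchainB hβB hslB)

end QuotChainPair

end Summit.Ventures.CertifiedManyBodySolver.Downfold

end
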